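import Mathlib.GroupTheory.Perm.Basic
import Mathlib.Algebra.Group.ConjFinite
import Mathlib.Analysis.SpecialFunctions.Pow.Real
import Mathlib.Analysis.SpecialFunctions.Sqrt
import Mathlib.Data.Nat.Factorial.Basic
import Literature.Combinatorics.Additive.TripleProductProperty
import Literature.RepresentationTheory.FiniteGroups.CharacterDegrees
import HarnessLib

/-!
# Barrier: three Young subgroups of `Sₙ` cannot prove non-trivial bounds on `ω` (Blasiak–Church–Cohn–Grochow–Umans 2017, §4)

Topic `Literature/Barriers/MatrixMultiplication` (D-0021 barrier catalogue for the summit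
`MatrixMultiplication`, `ω(ℂ) = 2`; group-theoretic approach of Cohn–Umans, triple product
property via three SUBGROUPS of the symmetric group — the "triangle construction" line of
Cohn–Umans 2003; cf. the route item `CNonabelianTPPFamilies` of
`MatrixMultiplication/GroupTheoreticSTPP`).

Source: J. Blasiak, T. Church, H. Cohn, J. A. Grochow, C. Umans, *Which groups are amenable to
proving exponent two for matrix multiplication?*, arXiv:1712.02302v1 (2017) (numbering of the
arXiv PDF, checked against a fetched copy: Def. 2.2, Thm. 2.3, Prop. 2.4 pp. 3–4; §4 with Thm. 4.1
(the triangle construction of Cohn–Umans 2003), the discussion of conjugacy classes of `Sₙ` and of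
the threshold `|Sₙ|^{1/2}/e^{o(√n)}`, Thm. 4.2, Lemma 4.3; §5, last paragraphs, on `Sₙ`). The held
store copy `paper:arxiv-1712.02302` carries a wrong title in its metadata ("Pseudorandom Bits for
Non-Commutative Programs") but the right text.

## Catalogue entry

The D-0021 structured block is in the docstring of the catalogue declaration
`YoungSubgroupBarrier` at the end of this file.

## Content

* `BCCGU2017_prop24` — Prop. 2.4, the conjugacy-class criterion (named fact, on the tree's
  `TripleProductProperty`, `charDegreePowSum`, and `Nat.card (ConjClasses G)`).
* `youngSubgroup f` — the Young subgroup of `Sₙ = Equiv.Perm (Fin n)` preserving the fibres of a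
  labelling `f : Fin n → α`, with `mem_youngSubgroup`, decidability, `youngSubgroup_const` (`= ⊤`),
  `youngSubgroup_eq_bot_of_injective` (`= ⊥`).
* `BCCGU2017_thm42` — Thm. 4.2 (named fact).
* PROVED: `inf_eq_bot_of_tripleProductProperty` (the TPP for three subgroups forces pairwise
  trivial intersections) and `young_no_nontrivial_bound` (Prop. 2.4 + Thm. 4.2 ⇒ whenever `Sₙ` has
  at most `e^{cn − d√n log n}` conjugacy classes, a Young TPP triple satisfies (2.1) for every
  `w > 0`, i.e. proves nothing about `ω`).
* Catalogue entry `YoungSubgroupBarrier : Prop := BCCGU2017_prop24 ∧ BCCGU2017_thm42`.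

## Design choices and wording risks

* Thm. 4.2 is printed with "universal constants `c, d > 0`" and no threshold on `n`; read
  literally it fails at `n = 1` (`log 1 = 0` makes the right-hand side `e^c > 1` while the left-hand
  side is `1`). It is an asymptotic statement (proof by induction with Stirling estimates,
  thresholds `t > 0.9n`, `t < e^{0.49}√n`), and for every `n ≥ 2` the factor `√n log n > 0` lets `d`
  absorb finitely many small cases; we therefore state it for `n ≥ 2`, which is equivalent to the
  printed claim for all `n` for which it can hold.
* Young subgroups are parametrised by labellings `Fin n → ℕ` (every set partition of `[n]` arises);
  `|Sₙ| = n!` is written as `n.factorial`, subgroup orders as `Nat.card`.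
* The headline "(2) symmetric groups `Sₙ` cannot prove nontrivial bounds on `ω` when the embedding
  is via three Young subgroups" is the COMBINATION Prop. 2.4 + Thm. 4.2 + `p(n) = e^{Θ(√n)}`
  (Hardy–Ramanujan); we prove the combination with the class-number bound as an explicit
  hypothesis (`young_no_nontrivial_bound`), the partition asymptotics not being in Mathlib.
* The alternating groups ("in the symmetric or alternating groups", §1) are not covered by the
  Lean statements.

## Audit 2026-08-16 (D-0021 barrier audit; additions only, statements unchanged)

Both conjuncts are tree theorems (`YoungSubgroupBarrierProofs.lean`: `BCCGU2017_prop24_holds`,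
`BCCGU2017_thm42_holds` with `c = 1/5`, `d = 3e⁷`, `YoungSubgroupBarrier_holds`), so the entry is
CONFIRMED; the page-level check of the quotations (held text `paper:arxiv-1712.02302`, chunks
2–4 and 9–11) found them accurate.  The audit sharpened the catalogue block below in three ways
(items marked "audit 2026-08-16"): (1) the evasion "STPP constructions" is closed for families all
of whose members are cosets of Young subgroups — the conjugacy-class criterion extends to STPP
families for every exponent `w ≥ 2` (`BCCGU2017_prop24_stpp`) and Thm. 4.2 applies member by
member (`young_stpp_no_nontrivial_bound_holds`), both proved in the companion file
`YoungSubgroupBarrierSTPP.lean`; (2) the paper's `Sₙ × Sₙ` remark concerns the HYPOTHESIS of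
Thm. 4.2 (pairwise trivial intersections), not a TPP evasion — its triple
`Sₙ × 1, 1 × Sₙ, ΔSₙ` violates the TPP — and product-Young TPP triples in `Sₙ × Sₘ` factor and stay
blocked; (3) cosets/translates of Young subgroups, the alternating groups, and the explicit range
of `n` are accounted for in `scope_caveats`.

Audit 2026-08-17 (of the ingredient file `YoungSubgroupCounting.lean`; docstring corrections only):
CONFIRMED again — the ingredients are kernel theorems and use only pairwise orthogonality of the
three partitions (details, the exact rate `e^{(1+o(1))n}` of Thm. 4.2 under the pairwise-trivial
hypothesis, and the 2017–2026 literature check are recorded in that file's module docstring).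
One transcription erratum is corrected here and in `because:` below: the printed small-part
threshold of the induction is `t < e^{0.49}√n` (so that `|Hᵢ| ≤ ((e^{0.49}√n)!)^{√n/e^{0.49}}
= n^{O(√n)} n^{n/2}/e^{0.51n}`, chunk 10 of the held text), not `t < e^{0.49√n}`; no Lean statement
depends on it.
-/

noncomputable section

open scoped BigOperators

namespace Literature.Barriers.MatrixMultiplication

open Literature.RepresentationTheory.FiniteGroups Literature.Combinatorics.Additive

/-! ## The conjugacy-class criterion (BCCGU 2017, Prop. 2.4) -/

/-- **BCCGU 2017, Proposition 2.4** (p. 3–4: "If `S, T, U ⊆ G` satisfy the Triple Product Property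
and `|G|/(|S||T||U|)^{2/3} ≥ #` conjugacy classes of `G`, then (2.1) is satisfied by all `ω > 0`
(and thus cannot even prove `ω < 3`)"), where (2.1) is the Cohn–Umans inequality
`(|S||T||U|)^{ω/3} ≤ ∑ᵢ dᵢ^ω` (BCCGU Thm. 2.3 = the tree's `CKSU2005_thm18`), `∑ᵢ dᵢ^w` is the
tree's `charDegreePowSum G w` and the number of conjugacy classes is `Nat.card (ConjClasses G)`.
Proof in print: `#Irr(G) = #` classes and `∑ dᵢ² = |G|` give `d_max² ≥ |G|/k ≥ (|S||T||U|)^{2/3}`.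
[cite: BlasiakChurchCohnGrochowUmans2017, Prop. 2.4] -/
def BCCGU2017_prop24 : Prop :=
  ∀ (G : Type) [Group G] [Fintype G] (S T U : Finset G), TripleProductProperty S T U →
    (Nat.card (ConjClasses G) : ℝ) * ((S.card * T.card * U.card : ℕ) : ℝ) ^ (2 / 3 : ℝ) ≤
        Fintype.card G →
      ∀ w : ℝ, 0 < w → ((S.card * T.card * U.card : ℕ) : ℝ) ^ (w / 3) ≤ charDegreePowSum G w

/-! ## Young subgroups -/

section Young

variable {n : ℕ} {α : Type*}

/-- The **Young subgroup** of `Sₙ = Equiv.Perm (Fin n)` attached to a labelling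
`f : Fin n → α` of `[n]`: the permutations preserving every fibre of `f`, i.e. the partition
`[n] = ⨆_a f⁻¹(a)` (BCCGU 2017, §4: "a Young subgroup of the symmetric group `Sₙ` is specified by a
partition of `[n]`, and consists of those permutations that preserve that partition. In particular,
every Young subgroup of `Sₙ` is isomorphic to `S_{n₁} × ⋯ × S_{n_k}`").
[cite: BlasiakChurchCohnGrochowUmans2017, §4] -/
def youngSubgroup (f : Fin n → α) : Subgroup (Equiv.Perm (Fin n)) where
  carrier := {σ | ∀ x, f (σ x) = f x}
  mul_mem' {σ τ} hσ hτ x := by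
    show f (σ (τ x)) = f x
    rw [hσ (τ x), hτ x]
  one_mem' x := rfl
  inv_mem' {σ} hσ x := by
    show f (σ.symm x) = f x
    have h := hσ (σ.symm x)
    rw [Equiv.apply_symm_apply] at h
    exact h.symm

/-- Membership in a Young subgroup. [folklore] -/
@[simp] theorem mem_youngSubgroup {f : Fin n → α} {σ : Equiv.Perm (Fin n)} :
    σ ∈ youngSubgroup f ↔ ∀ x, f (σ x) = f x := Iff.rfl

/-- Membership in a Young subgroup is decidable for labels with decidable equality. [folklore] -/
instance decidableMemYoungSubgroup [DecidableEq α] (f : Fin n → α) :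
    DecidablePred (· ∈ youngSubgroup f) :=
  fun σ => decidable_of_iff (∀ x, f (σ x) = f x) Iff.rfl

/-- A constant labelling gives the whole symmetric group. [folklore] -/
theorem youngSubgroup_const (a : α) : youngSubgroup (fun _ : Fin n => a) = ⊤ := by
  ext σ; simp

/-- An injective labelling (the partition into singletons) gives the trivial subgroup. [folklore] -/
theorem youngSubgroup_eq_bot_of_injective {f : Fin n → α} (hf : Function.Injective f) :
    youngSubgroup f = ⊥ := by
  ext σ
  simp only [mem_youngSubgroup, Subgroup.mem_bot]
  constructor
  · intro h; ext x; exact congrArg Fin.val (hf (h x))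
  · rintro rfl x; rfl

end Young

/-! ## BCCGU 2017, Thm. 4.2 (statement) -/

/-- **BCCGU 2017, Theorem 4.2** (p. 13: "Let `H₁, H₂, H₃ ⊆ Sₙ` be Young subgroups such that
`H₁ ∩ H₂ = H₂ ∩ H₃ = H₁ ∩ H₃ = {1}`. There exists universal constants `c, d > 0` for which
`|Sₙ|/(|H₁||H₂||H₃|)^{2/3} ≥ e^{cn − d√n log n}`"). Young subgroups are `youngSubgroup fᵢ` for
labellings `fᵢ : Fin n → ℕ`; `|Sₙ| = n!`; stated for `n ≥ 2` (for `n = 1` the printed right-hand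
side is `e^c > 1 = ` left-hand side, a degenerate case outside the theorem's asymptotic content,
see the module docstring). Trivial pairwise intersections are necessary for the TPP.
[cite: BlasiakChurchCohnGrochowUmans2017, Thm. 4.2] -/
def BCCGU2017_thm42 : Prop :=
  ∃ c d : ℝ, 0 < c ∧ 0 < d ∧ ∀ n : ℕ, 2 ≤ n → ∀ (f₁ f₂ f₃ : Fin n → ℕ),
    youngSubgroup f₁ ⊓ youngSubgroup f₂ = ⊥ → youngSubgroup f₂ ⊓ youngSubgroup f₃ = ⊥ →
    youngSubgroup f₁ ⊓ youngSubgroup f₃ = ⊥ →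
      Real.exp (c * n - d * Real.sqrt n * Real.log n) ≤
        (n.factorial : ℝ) /
          ((Nat.card (youngSubgroup f₁) * Nat.card (youngSubgroup f₂) *
              Nat.card (youngSubgroup f₃) : ℕ) : ℝ) ^ (2 / 3 : ℝ)

/-! ## Consequence: no non-trivial bound on `ω` from three Young subgroups (proved from the facts) -/

/-- Subgroups with pairwise trivial intersection is what the TPP needs; conversely the TPP for
three subgroups (as finite sets) forces pairwise trivial intersections: if `1 ≠ g ∈ H₁ ∩ H₂` then
`g · g⁻¹ · 1 = 1` violates it. [cite: BlasiakChurchCohnGrochowUmans2017, §4 (before Thm. 4.2)] -/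
theorem inf_eq_bot_of_tripleProductProperty {G : Type*} [Group G] [Fintype G] [DecidableEq G]
    (H₁ H₂ H₃ : Subgroup G) [DecidablePred (· ∈ H₁)] [DecidablePred (· ∈ H₂)]
    [DecidablePred (· ∈ H₃)]
    (h : TripleProductProperty (Finset.univ.filter (· ∈ H₁)) (Finset.univ.filter (· ∈ H₂))
      (Finset.univ.filter (· ∈ H₃))) :
    H₁ ⊓ H₂ = ⊥ ∧ H₂ ⊓ H₃ = ⊥ ∧ H₁ ⊓ H₃ = ⊥ := by
  have mem : ∀ {H : Subgroup G} [DecidablePred (· ∈ H)] {g : G}, g ∈ H →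
      g ∈ Finset.univ.filter (· ∈ H) := fun hg => by simpa using hg
  refine ⟨?_, ?_, ?_⟩
  · refine (Subgroup.eq_bot_iff_forall _).2 fun g hg => ?_
    obtain ⟨hg1, hg2⟩ := Subgroup.mem_inf.1 hg
    have key := h g (mem hg1) 1 (mem H₁.one_mem) g⁻¹ (mem (H₂.inv_mem hg2)) 1 (mem H₂.one_mem)
      1 (mem H₃.one_mem) 1 (mem H₃.one_mem) (by group)
    exact key.1
  · refine (Subgroup.eq_bot_iff_forall _).2 fun g hg => ?_
    obtain ⟨hg2, hg3⟩ := Subgroup.mem_inf.1 hg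
    have key := h 1 (mem H₁.one_mem) 1 (mem H₁.one_mem) g (mem hg2) 1 (mem H₂.one_mem)
      g⁻¹ (mem (H₃.inv_mem hg3)) 1 (mem H₃.one_mem) (by group)
    exact key.2.1
  · refine (Subgroup.eq_bot_iff_forall _).2 fun g hg => ?_
    obtain ⟨hg1, hg3⟩ := Subgroup.mem_inf.1 hg
    have key := h g (mem hg1) 1 (mem H₁.one_mem) 1 (mem H₂.one_mem) 1 (mem H₂.one_mem)
      g⁻¹ (mem (H₃.inv_mem hg3)) 1 (mem H₃.one_mem) (by group)
    exact key.1

/-- **No non-trivial bound from three Young subgroups (BCCGU 2017, §1 result (2) / §4), proved from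
Prop. 2.4 and Thm. 4.2**: with the constants `c, d` of Thm. 4.2, for every `n ≥ 2` such that `Sₙ`
has at most `e^{cn − d√n log n}` conjugacy classes (true for all large `n`, the class number being
the partition number `p(n) = e^{Θ(√n)}` — BCCGU §4), every triple of Young subgroups with the
triple product property satisfies the Cohn–Umans inequality (2.1) for ALL `w > 0`, so proves
nothing about `ω` ("the subgroups `S, T, U` are very slightly too small").
[cite: BlasiakChurchCohnGrochowUmans2017, §4 (Thm. 4.2 and the discussion of Thm. 4.1)] -/
theorem young_no_nontrivial_bound (h24 : BCCGU2017_prop24) (h42 : BCCGU2017_thm42) :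
    ∃ c d : ℝ, 0 < c ∧ 0 < d ∧ ∀ n : ℕ, 2 ≤ n →
      (Nat.card (ConjClasses (Equiv.Perm (Fin n))) : ℝ) ≤
          Real.exp (c * n - d * Real.sqrt n * Real.log n) →
      ∀ (f₁ f₂ f₃ : Fin n → ℕ),
        TripleProductProperty (Finset.univ.filter (· ∈ youngSubgroup f₁))
          (Finset.univ.filter (· ∈ youngSubgroup f₂))
          (Finset.univ.filter (· ∈ youngSubgroup f₃)) →
        ∀ w : ℝ, 0 < w →
          (((Finset.univ.filter (· ∈ youngSubgroup f₁)).card *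
              (Finset.univ.filter (· ∈ youngSubgroup f₂)).card *
              (Finset.univ.filter (· ∈ youngSubgroup f₃)).card : ℕ) : ℝ) ^ (w / 3) ≤
            charDegreePowSum (Equiv.Perm (Fin n)) w := by
  obtain ⟨c, d, hc, hd, h⟩ := h42
  refine ⟨c, d, hc, hd, fun n hn hclass f₁ f₂ f₃ hTPP w hw => ?_⟩
  obtain ⟨h12, h23, h13⟩ := inf_eq_bot_of_tripleProductProperty _ _ _ hTPP
  have hbound := h n hn f₁ f₂ f₃ h12 h23 h13
  refine h24 (Equiv.Perm (Fin n)) _ _ _ hTPP ?_ w hw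
  -- `|Sₙ| = n!`, the three filtered sets are the subgroups, and `k · P^{2/3} ≤ n!`
  have hcardS : (Fintype.card (Equiv.Perm (Fin n)) : ℝ) = n.factorial := by
    rw [Fintype.card_perm, Fintype.card_fin]
  have hfilter : ∀ (H : Subgroup (Equiv.Perm (Fin n))) [DecidablePred (· ∈ H)],
      ((Finset.univ.filter (· ∈ H)).card : ℕ) = Nat.card H := by
    intro H _
    rw [Nat.card_eq_fintype_card (α := ↥H),
      Fintype.card_of_subtype (Finset.univ.filter (· ∈ H)) (fun x => by simp)]
  have hP : ((Finset.univ.filter (· ∈ youngSubgroup f₁)).card *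
      (Finset.univ.filter (· ∈ youngSubgroup f₂)).card *
      (Finset.univ.filter (· ∈ youngSubgroup f₃)).card : ℕ) =
      Nat.card (youngSubgroup f₁) * Nat.card (youngSubgroup f₂) * Nat.card (youngSubgroup f₃) := by
    rw [hfilter, hfilter, hfilter]
  rw [hP, hcardS]
  set P : ℕ := Nat.card (youngSubgroup f₁) * Nat.card (youngSubgroup f₂) *
    Nat.card (youngSubgroup f₃) with hPdef
  have hP0 : (0 : ℝ) < (P : ℝ) ^ (2 / 3 : ℝ) := by
    have : 0 < P := by
      rw [hPdef]; exact Nat.mul_pos (Nat.mul_pos Nat.card_pos Nat.card_pos) Nat.card_pos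
    exact Real.rpow_pos_of_pos (by exact_mod_cast this) _
  rw [le_div_iff₀ hP0] at hbound
  exact (mul_le_mul_of_nonneg_right hclass hP0.le).trans hbound

/-! ## Catalogue entry (D-0021) -/

section Catalogue

/-- **Three Young subgroups of `Sₙ` are "very slightly too small" (Blasiak–Church–Cohn–Grochow–Umans
2017, Prop. 2.4 and Thm. 4.2).** The catalogue entry is Prop. 2.4 ∧ Thm. 4.2 (named facts); their
combination is proved above (`young_no_nontrivial_bound`).

BARRIER
technique_class: group-theoretic-approach, Cohn–Umans, triple-product-property via three Young subgroups `H₁, H₂, H₃ ≤ Sₙ` (`youngSubgroup`; includes the triangle construction of Cohn–Umans 2003 = BCCGU Thm. 4.1, the hexagon and all "stretched" shapes — "a natural strategy that includes all known constructions in `Sₙ`"), conjugacy-class criterion for single TPP triples in any finite group (`BCCGU2017_prop24`)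
blocks: any bound `ω < 3` — a fortiori `MatrixMultiplication` (`ω = 2`) — obtained from the Cohn–Umans inequality `(|S||T||U|)^{ω/3} ≤ ∑ᵢ dᵢ^ω` (BCCGU Thm. 2.3 = Cohn–Umans 2003 = the tree's `CKSU2005_thm18`) with three Young subgroups of `Sₙ`: "`|Sₙ|/(|H₁||H₂||H₃|)^{2/3} ≥ e^{cn − d√n log n}`" for universal `c, d > 0` whenever the pairwise intersections are trivial (necessary for the TPP) (`BCCGU2017_thm42`) [cite: BlasiakChurchCohnGrochowUmans2017, Thm. 4.2], while "If `S, T, U ⊆ G` satisfy the Triple Product Property and `|G|/(|S||T||U|)^{2/3} ≥ #` conjugacy classes of `G`, then (2.1) is satisfied by all `ω > 0` (and thus cannot even prove `ω < 3`)" (`BCCGU2017_prop24`) [cite: BlasiakChurchCohnGrochowUmans2017, Prop. 2.4] and `Sₙ` has `p(n) = e^{Θ(√n)}` conjugacy classes [cite: BlasiakChurchCohnGrochowUmans2017, §4 (discussion after Thm. 4.1)]; combined: `young_no_nontrivial_bound` (proved). In particular the triangle construction (`|S| = |T| = |U| = |Sₙ|^{1/2−o(1)}`, the only known construction meeting the packing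 bound) proves nothing: "`|S| = |T| = |U| ≤ |Sₙ|^{1/2}/e^{Ω(n)}` … the subgroups `S, T, U` are very slightly too small" [cite: BlasiakChurchCohnGrochowUmans2017, §4 (Thm. 4.1 and following)].
because: `#Irr(G) = #` conjugacy classes `k` and `∑ dᵢ² = |G|` give `d_max² ≥ |G|/k ≥ (|S||T||U|)^{2/3}`, so `(|S||T||U|)^{ω/3} ≤ d_max^ω ≤ ∑ dᵢ^ω` for every `ω > 0` [cite: BlasiakChurchCohnGrochowUmans2017, Prop. 2.4 (proof)]; Thm. 4.2 is "a fairly delicate induction" on `n` over the largest part `t` of the three partitions (cases `t > 0.9n`, `t < e^{0.49}√n`, and a recursion removing the part of size `t`, with Stirling's formula and Lemma 4.3), using only that the three Young subgroups have trivial pairwise intersections [cite: BlasiakChurchCohnGrochowUmans2017, Thm. 4.2 (proof) and Lemma 4.3].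
evasions_known: sets of size `|S| = |T| = |U| ≥ |Sₙ|^{1/2}/e^{o(√n)}` WOULD prove `ω = 2` via Thm. 2.3, and "one can achieve this bound for two of the three subgroups by 'stretching' the triangle in one direction" [cite: BlasiakChurchCohnGrochowUmans2017, §4 (before Thm. 4.2)]; arbitrary subsets or non-Young subgroups of `Sₙ` are not excluded ("A smaller step in the direction of ruling out `ω = 2` in the symmetric group would be to extend our result to all triples of subgroups (not just Young subgroups)"), nor are small variations of the group "like the direct product of a small number of symmetric groups … It is intriguing that altering the setup in certain small ways — for example by considering the direct product of two symmetric groups — breaks the argument" [cite: BlasiakChurchCohnGrochowUmans2017, §5 and §1.1]; none published achieving a bound. (audit 2026-08-16, additions:) (i) STPP families are NOT an evasion as long as every member set is a coset of a Young subgroup: the conjugacy-class criterion holds for STPP families (CKSU 2005 Def. 5.1, the tree's `SimultaneousTPP`) in any finite group for every `w ≥ 2` — if each member has `k(G)·(|Aᵢ||Bᵢ||Cᵢ|)^{2/3} ≤ |G|` then `∑ᵢ (|Aᵢ||Bᵢ||Cᵢ|)^{w/3} ≤ ∑_χ χ(1)^w` (power mean over `Irr(G)`, `∑χ(1)² = |G|`,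 and the three packing bounds `∑|Aᵢ||Bᵢ|, ∑|Bᵢ||Cᵢ|, ∑|Cᵢ||Aᵢ| ≤ |G|`; `BCCGU2017_prop24_stpp`, proved in `YoungSubgroupBarrierSTPP.lean`), and a member triple of right cosets `Y(α)a, Y(β)b, Y(γ)c` has the TPP iff `(Y(α), Y(β), Y(γ))` has it (`tripleProductProperty_image_mul_right_iff`), whence pairwise trivial intersections and Thm. 4.2 member by member (`young_stpp_no_nontrivial_bound_holds`, same class-number hypothesis; every two-sided translate `x·Y(f)·y = Y(f∘x⁻¹)·(xy)` is such a coset) — so the CKSU inequality `∑ᵢ(aᵢbᵢcᵢ)^{ω/3} ≤ ∑ d_k^ω` (Thm. 5.5) is uninformative for such families exactly as (2.1) is for one triple, and an STPP evasion in `Sₙ` needs a member set that is not a Young coset [cite: CohnKleinbergSzegedyUmans2005, Def. 5.1 and Thm. 5.5] [cite: BlasiakChurchCohnGrochowNaslundSawinUmans2017, §2 (packing bounds)]; (ii) the paper's own `Sₙ²` example — "the three subgroups `S = Sₙ × {1}`, `T = {1} × Sₙ`, and `U = {(π, π)}` of `G = Sₙ²` satisfy the conditions of the theorem (have pairwise trivial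 intersection) and have largest-possible size" — shows only that the HYPOTHESIS of Thm. 4.2 (pairwise triviality) is too weak outside `Sₙ`: this triple violates the TPP (`(σ,1)(1,σ)(σ⁻¹,σ⁻¹) = 1`), and inside `Sₙ` the same phenomenon (pairwise-trivial non-Young subgroup triples near `(n!)^{3/2}`) is the business of route `SnThresholdCensus`; genuinely product-type Young TPP triples `(Y(αᵢ) × Y(α'ᵢ))ᵢ` in `Sₙ × Sₘ` factor — a triple of direct products of subgroups has the TPP iff both factor triples do — so `|G|/P^{2/3} = (n!/P₁^{2/3})(m!/P₂^{2/3}) ≥ e^{cn − d√n log n}` against `k(Sₙ × Sₘ) = p(n)p(m)`, blocked for large `n` [cite: BlasiakChurchCohnGrochowUmans2017, §4 (paragraph after the proof of Thm. 4.2)]; (iii) literature after 2017 (searched 2026-08-16: forward citations, arXiv/OpenAlex "triple product property" + symmetric/Young/subgroup, Hedtke–Murthy/Neumann capacity papers incl. arXiv:2512.16730, arXiv:2602.15796): no extension of Thm. 4.2 to all subgroup or subset triples of `Sₙ` and no construction in `Sₙ`/`Aₙ` beyond Young subgroups has appeared; the sequel on simple groups states "the alternating groups are the only simple groups left that could yield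 `ω = 2` via a triple product property construction. The representation-theoretic argument fails in this case, since `A_n` has an irreducible representation of dimension `n−1` but `|A_n| = n!/2`. Can an alternate argument rule out these groups?" [cite: BlasiakCohnGrochowPrattUmans2023, §5].
scope_caveats: (a) only triples of YOUNG subgroups (partition stabilisers) in `Sₙ` are covered — not other subgroups, not subsets, not STPP constructions, not `Sₙ × Sₘ` [cite: BlasiakChurchCohnGrochowUmans2017, §5]; (b) Thm. 4.2 bounds `|Sₙ|/(|H₁||H₂||H₃|)^{2/3}` only; "no non-trivial bound on `ω`" follows through Prop. 2.4 and the class number `p(n) = e^{Θ(√n)}`, hence for all sufficiently large `n` (the Lean combination keeps the class-number inequality as a hypothesis; the partition asymptotics are not in Mathlib) [cite: BlasiakChurchCohnGrochowUmans2017, Prop. 2.4 and §4]; (c) Thm. 4.2 is vendored for `n ≥ 2` (the printed display is false at `n = 1`, where `log 1 = 0`), constants `c, d` inexplicit as in print; (d) the alternating groups, mentioned in §1 ("in the symmetric or alternating groups"), are not covered by the Lean statements; (audit 2026-08-16, additions:) (a′) in (a), "not STPP constructions" is to be read "not STPP families with a non-Young member": families of Young cosets are covered (evasions_known (i)); likewise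 right/left/two-sided translates of Young subgroups (`Y(f)g`, `gY(f) = Y(f∘g⁻¹)g`) are covered although `no_nontrivial_bound` is stated for the subgroups themselves — the TPP and the set sizes only see the quotient sets `Q(S) = SS⁻¹ = Y` (`tripleProductProperty_image_mul_right_iff` in `YoungSubgroupBarrierSTPP.lean`, or the one-member case of `young_stpp_no_nontrivial_bound_holds`); (b′) explicit range: with the tree's constants the displayed bound `e^{n/5 − 3e⁷√n log n}` exceeds `1` only for `n ≳ 1.8·10¹¹`, but the large-`n` branch of the tree proof (`young_sum_log_le_of_costs`, `log n ≥ 14`) gives `log(n!/(|H₁||H₂||H₃|)^{2/3}) ≥ n/5` with no lower-order loss for every `n ≥ e^{14} ≈ 1.2·10⁶`, which beats `log p(n) < π√(2n/3)` there; for `2 ≤ n < e^{14}` neither the printed theorem (inexplicit `c, d`) nor the tree statement says anything, which is immaterial for `ω = 2` (a family `n → ∞` is needed) and leaves only "some bound `ω < 3` from one moderate `n`" formally unaddressed (at such `n` the hypothesis of Prop. 2.4 can genuinely fail without any bound resulting: for `n = 4` the largest Young TPP triple is `⟨(12),(34)⟩, ⟨(13),(24)⟩, ⟨(14)⟩` —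 the three pair-partitions `{12|34}, {13|24}, {14|23}` are pairwise orthogonal but violate the TPP, `(12)(34)·(13)(24) = (14)(23)` — with `P = 32`, `P^{1/3} ≈ 3.17 > 3 = d_max(S₄)` and `4!/P^{2/3} ≈ 2.4 < 5 = p(4)`, yet `∑_λ (f^λ/P^{1/3})^w ≥ 2·(3/3.18)^3 > 1.6` on `[2,3]`, so (2.1) fails only for `w > 3` and says nothing; an exhaustive census of `n ≤ 7` was queued as compute job `j007753` by the audit); no constant `c > 1` is possible in Thm. 4.2 as stated (three parallel classes of `𝔽_q²`, pairwise trivial — though not TPP — give `e^{n + O(√n log n)}`; see `YoungSubgroupBarrierProofs.lean`); (d′) for `Aₙ` with "Young subgroups" `Aₙ ∩ Y(π)`: pairwise triviality now allows one 2-point block in each meet `πᵢ ∧ πⱼ`; splitting at most three points off restores pairwise-orthogonal partitions at a loss `≤ n³` in `|H₁||H₂||H₃|`, and `|Aₙ ∩ Y| ≥ |Y|/2`, `k(Aₙ) ≤ 2p(n)`, so the `Aₙ` claim of §1 follows from Thm. 4.2 with `d` enlarged (on paper; not a Lean statement here).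
status: theorem (established) [cite: BlasiakChurchCohnGrochowUmans2017, Thm. 4.2 and Prop. 2.4] -/
def YoungSubgroupBarrier : Prop :=
  BCCGU2017_prop24 ∧ BCCGU2017_thm42

/-- Projection: Prop. 2.4. [cite: BlasiakChurchCohnGrochowUmans2017, Prop. 2.4] -/
theorem YoungSubgroupBarrier.prop24 (h : YoungSubgroupBarrier) : BCCGU2017_prop24 := h.1

/-- Projection: Thm. 4.2. [cite: BlasiakChurchCohnGrochowUmans2017, Thm. 4.2] -/
theorem YoungSubgroupBarrier.thm42 (h : YoungSubgroupBarrier) : BCCGU2017_thm42 := h.2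

/-- The barrier's conclusion: with the constants of Thm. 4.2, for every `n ≥ 2` with at most
`e^{cn − d√n log n}` conjugacy classes in `Sₙ`, three Young subgroups with the TPP satisfy the
Cohn–Umans inequality for all `w > 0` (prove nothing about `ω`).
[cite: BlasiakChurchCohnGrochowUmans2017, Thm. 4.2 and Prop. 2.4] -/
theorem YoungSubgroupBarrier.no_nontrivial_bound (h : YoungSubgroupBarrier) :
    ∃ c d : ℝ, 0 < c ∧ 0 < d ∧ ∀ n : ℕ, 2 ≤ n →
      (Nat.card (ConjClasses (Equiv.Perm (Fin n))) : ℝ) ≤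
          Real.exp (c * n - d * Real.sqrt n * Real.log n) →
      ∀ (f₁ f₂ f₃ : Fin n → ℕ),
        TripleProductProperty (Finset.univ.filter (· ∈ youngSubgroup f₁))
          (Finset.univ.filter (· ∈ youngSubgroup f₂))
          (Finset.univ.filter (· ∈ youngSubgroup f₃)) →
        ∀ w : ℝ, 0 < w →
          (((Finset.univ.filter (· ∈ youngSubgroup f₁)).card *
              (Finset.univ.filter (· ∈ youngSubgroup f₂)).card *
              (Finset.univ.filter (· ∈ youngSubgroup f₃)).card : ℕ) : ℝ) ^ (w / 3) ≤
            charDegreePowSum (Equiv.Perm (Fin n)) w :=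
  young_no_nontrivial_bound h.1 h.2

end Catalogue

end Literature.Barriers.MatrixMultiplication
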